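import Literature.AlgebraicGeometry.Modules.EpiOfSameRankIsIso
import Literature.AlgebraicGeometry.Modules.SectionsExact
import Literature.AlgebraicGeometry.Modules.DetClassOfIso
import Mathlib.Algebra.Category.ModuleCat.Biproducts
import Mathlib.LinearAlgebra.Dimension.Constructions
import HarnessLib

/-!
# The kernel of an epimorphism between modules of constant rank has the complementary rank

On any scheme `X`, let `φ : E ⟶ F` be an epimorphism of `𝒪_X`-modules with `E` of rank `n` and
`F` of rank `k` (locally free of these constant ranks, the tree's `Motives.HasRank`). Then

* `hasRank_kernel_of_epi` — **`ker φ` has rank `n − k`**;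
* `le_of_epi_of_hasRank` — `k ≤ n` as soon as `X` has a point.

The Stacks Project, Tag 05P2 (with Tag 00NX): the kernel of a surjection of finite locally free
modules is finite locally free (in the tree: `isFiniteLocallyFree_kernel`); the RANK count is the
rank–nullity of a split surjection of finite free modules over the (nontrivial) ring of a small
affine open on which `ker φ`, `E` and `F` are simultaneously free (`card_add_card_eq_card_of_exact`:
`0 → B^I → B^J → B^K → 0` exact ⇒ `#I + #K = #J`, since `B^K` is projective and commutative rings
have the strong rank condition). Görtz–Wedhorn use exactly this for the tautological sequence
`0 → 𝒦 → π^*ℰ → 𝒬 → 0` of the Grassmannian ("an exact sequence of finite locally free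
`𝒪_X`-modules", II Thm. 17.46 with (8.4) of vol. I), which is the consumer
`Motives/GrassmannianUniversalSubbundle`.

Everything is proved; theorems only (no definitions, facts, instances, notation).

## References

* The Stacks Project, Tags 05P2 and 00NX. [StacksProject]
* U. Görtz, T. Wedhorn, *Algebraic Geometry I*, 2nd ed. (2020), (8.4) (pp. 213–215).
  [GortzWedhorn2020]
* U. Görtz, T. Wedhorn, *Algebraic Geometry II*, Springer Spektrum (2023), (17.7) and Thm. 17.46
  (pp. 22–23; held e-text pp. 60–61). [GortzWedhorn2023]
* R. Hartshorne, *Algebraic Geometry*, GTM 52 (1977), II Prop. 5.6 (p. 113), II Ex. 5.7–5.8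
  (pp. 123–124). [Hartshorne1977]
-/

noncomputable section

-- `Scheme.Modules` section API is stated across semireducible wrappers (as in Mathlib's own files).
set_option backward.isDefEq.respectTransparency false

open CategoryTheory CategoryTheory.Limits AlgebraicGeometry TopologicalSpace Opposite
open Literature.AlgebraicGeometry.Motives Literature.AlgebraicGeometry.Morphisms

universe u

namespace Literature.AlgebraicGeometry.Modules

/-! ### Rank–nullity for a surjection of finite free modules over a commutative ring -/

/-- **Rank–nullity over a commutative ring**: if `0 → P → M → N → 0` is exact (`j` injective with
range the kernel of the surjection `g`) and `P`, `M`, `N` have finite bases indexed by `I`, `J`, `K`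
over a nontrivial commutative ring, then `#I + #K = #J` (the sequence splits since `N` is free,
and free modules over a commutative ring have well-defined rank).
[cite: StacksProject, Tag 00NX] -/
theorem card_add_card_eq_card_of_exact {B : Type*} [CommRing B] [Nontrivial B]
    {P M N : Type*} [AddCommGroup P] [Module B P] [AddCommGroup M] [Module B M]
    [AddCommGroup N] [Module B N] {I J K : Type*} [Fintype I] [Fintype J] [Fintype K]
    (bP : Module.Basis I B P) (bM : Module.Basis J B M) (bN : Module.Basis K B N)
    (j : P →ₗ[B] M) (g : M →ₗ[B] N) (hj : Function.Injective j)
    (hjg : LinearMap.range j = LinearMap.ker g) (hg : Function.Surjective g) :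
    Fintype.card I + Fintype.card K = Fintype.card J := by
  haveI : Module.Free B N := Module.Free.of_basis bN
  haveI : Module.Projective B N := Module.Projective.of_free
  obtain ⟨s, hs⟩ := Module.projective_lifting_property g LinearMap.id hg
  let e : (P × N) ≃ₗ[B] M := lequivProdOfRightSplitExact hj hjg hs
  haveI : Module.Free B P := Module.Free.of_basis bP
  haveI : Module.Finite B P := Module.Finite.of_basis bP
  haveI : Module.Finite B N := Module.Finite.of_basis bN
  rw [← Module.finrank_eq_card_basis bP, ← Module.finrank_eq_card_basis bN,
    ← Module.finrank_eq_card_basis bM, ← e.finrank_eq, Module.finrank_prod]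

/-! ### The rank of the kernel -/

variable {X : Scheme.{u}} {E F : X.Modules} (φ : E ⟶ F) [Epi φ]

omit [Epi φ] in
/-- On sections over any open, `Γ(V, ker φ) → Γ(V, E)` has range the kernel of `φ_V`
(sections are left exact). [cite: Hartshorne1977, II Ex. 1.8 p. 66] -/
theorem range_appLinear_kernel_ι (V : X.Opens) :
    LinearMap.range (appLinear (kernel.ι φ) V) = LinearMap.ker (appLinear φ V) := by
  ext m
  constructor
  · rintro ⟨m', rfl⟩
    exact app_kernel_ι_app φ V m'
  · intro hm
    obtain ⟨m', hm'⟩ := exists_kernel_ι_app_eq φ V m hm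
    exact ⟨m', hm'⟩

/-- **The rank count near a point**: if `E` has rank `n`, `F` has rank `k`, `φ : E ⟶ F` is an
epimorphism and `𝒪^I ≅ (ker φ)|_U` is a frame of the kernel on an open `U` containing a point, then
`#I + k = n`. [cite: StacksProject, Tags 05P2 and 00NX] -/
theorem card_add_eq_of_frame_kernel {n k : ℕ} (hE : HasRank E n) (hF : HasRank F k) {x : X}
    {U : X.Opens} (hxU : x ∈ U) {I : Type u} [Fintype I]
    (e : SheafOfModules.free I ≅ (kernel φ).over U) : Fintype.card I + k = n := by
  obtain ⟨FE, hFE⟩ := exists_frameSystem_of_hasRank hE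
  obtain ⟨FF, hFF⟩ := exists_frameSystem_of_hasRank hF
  have hEl : IsAffineLocalizing E := (coh_of_isVectorBundle FE.isFiniteLocallyFree.isVectorBundle).loc
  have hFl : IsAffineLocalizing F := (coh_of_isVectorBundle FF.isFiniteLocallyFree.isVectorBundle).loc
  -- an affine open `V ∋ x` inside the three frame opens
  obtain ⟨_, ⟨V, hV, rfl⟩, hxV, hVle⟩ := X.isBasis_affineOpens.exists_subset_of_mem_open
    (show x ∈ U ⊓ (FE.U x ⊓ FF.U x) from ⟨hxU, FE.mem x, FF.mem x⟩) (U ⊓ (FE.U x ⊓ FF.U x)).2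
  have hVU : V ≤ U := fun y hy => (hVle hy).1
  have hVE : V ≤ FE.U x := fun y hy => (hVle hy).2.1
  have hVF : V ≤ FF.U x := fun y hy => (hVle hy).2.2
  -- bases of the sections over `V`
  haveI : Fintype (FE.I x) := Fintype.ofEquiv _ (FE.enum x).symm
  haveI : Fintype (FF.I x) := Fintype.ofEquiv _ (FF.enum x).symm
  obtain ⟨bK⟩ := nonempty_basis_of_frame
    (SheafOfModules.restrictTrivialisation (R := X.ringCatSheaf) (homOfLE hVU) e)
  obtain ⟨bE⟩ := nonempty_basis_of_frame
    (SheafOfModules.restrictTrivialisation (R := X.ringCatSheaf) (homOfLE hVE) (FE.frame x))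
  obtain ⟨bF⟩ := nonempty_basis_of_frame
    (SheafOfModules.restrictTrivialisation (R := X.ringCatSheaf) (homOfLE hVF) (FF.frame x))
  -- `Γ(X, V)` is nontrivial (`x ∈ V`) and `0 → Γ(V, ker φ) → Γ(V, E) → Γ(V, F) → 0` is exact
  haveI : Nonempty V := ⟨⟨x, hxV⟩⟩
  have hcount := card_add_card_eq_card_of_exact bK bE bF (appLinear (kernel.ι φ) V) (appLinear φ V)
    (kernel_ι_app_injective φ V) (range_appLinear_kernel_ι φ V) (app_surjective_of_epi φ hEl hFl hV)
  rw [Fintype.card_congr (FE.enum x), Fintype.card_congr (FF.enum x), Fintype.card_fin,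
    Fintype.card_fin, hFE x, hFF x] at hcount
  exact hcount

include φ in
/-- **`k ≤ n` for an epimorphism from a rank-`n` module onto a rank-`k` module over a scheme with a
point.** [cite: StacksProject, Tags 05P2 and 00NX] -/
theorem le_of_epi_of_hasRank {n k : ℕ} (hE : HasRank E n) (hF : HasRank F k) (x : X) : k ≤ n := by
  obtain ⟨U, hxU, I, hI, ⟨e⟩⟩ :=
    isFiniteLocallyFree_kernel φ (HasRank.isFiniteLocallyFree' hE)
    (HasRank.isFiniteLocallyFree' hF) x
  haveI := Fintype.ofFinite I
  have h := card_add_eq_of_frame_kernel φ hE hF hxU e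
  omega

/-- **The kernel of an epimorphism from a rank-`n` module onto a rank-`k` module has rank `n − k`**
(Stacks 05P2: the kernel is finite locally free; its local frames have `n − k` members by the rank
count `card_add_eq_of_frame_kernel`). [cite: StacksProject, Tags 05P2 and 00NX]
[cite: GortzWedhorn2023, (17.7) and Thm. 17.46 (pp. 22–23)] -/
theorem hasRank_kernel_of_epi {n k : ℕ} (hE : HasRank E n) (hF : HasRank F k) :
    HasRank (kernel φ) (n - k) := by
  classical
  have hK := isFiniteLocallyFree_kernel φ (HasRank.isFiniteLocallyFree' hE)
    (HasRank.isFiniteLocallyFree' hF)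
  choose U hxU I hI e using hK
  haveI : ∀ x, Fintype (I x) := fun x => Fintype.ofFinite (I x)
  have hcard : ∀ x, Fintype.card (I x) = n - k := fun x => by
    have h := card_add_eq_of_frame_kernel φ hE hF (hxU x) (Classical.choice (e x))
    omega
  exact FrameSystem.hasRank (E := kernel φ)
    { U := U
      mem := hxU
      I := I
      rank := fun _ => n - k
      enum := fun x => Fintype.equivFinOfCardEq (hcard x)
      frame := fun x => Classical.choice (e x) } (n - k) fun _ => rfl

/-- The kernel of an epimorphism between modules of constant rank is finite locally free
(`hasRank_kernel_of_epi`, forgetful form; cf. `isFiniteLocallyFree_kernel`).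
[cite: StacksProject, Tags 05P2 and 00NX] -/
theorem isFiniteLocallyFree_kernel_of_hasRank {n k : ℕ} (hE : HasRank E n) (hF : HasRank F k) :
    IsFiniteLocallyFree (kernel φ) :=
  HasRank.isFiniteLocallyFree' (hasRank_kernel_of_epi φ hE hF)

/-- The kernel of an epimorphism between modules of constant rank is affine-localizing
(quasi-coherent bookkeeping for the sections of the kernel on affine opens).
[cite: Hartshorne1977, II Prop. 5.6 (p. 113)] -/
theorem isAffineLocalizing_kernel_of_hasRank {n k : ℕ} (hE : HasRank E n) (hF : HasRank F k) :
    IsAffineLocalizing (kernel φ) :=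
  (coh_of_isVectorBundle (isFiniteLocallyFree_kernel_of_hasRank φ hE hF).isVectorBundle).loc

/-- **Sections of the kernel on an affine open**: for an epimorphism `φ : E ⟶ F` between modules of
constant rank and an affine open `V`, `0 → Γ(V, ker φ) → Γ(V, E) → Γ(V, F) → 0` is exact — the
last map is onto. [cite: Hartshorne1977, II Prop. 5.6 (p. 113)] -/
theorem app_surjective_of_epi_of_hasRank {n k : ℕ} (hE : HasRank E n) (hF : HasRank F k)
    {V : X.Opens} (hV : IsAffineOpen V) : Function.Surjective (φ.app V) := by
  obtain ⟨FE, -⟩ := exists_frameSystem_of_hasRank hE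
  obtain ⟨FF, -⟩ := exists_frameSystem_of_hasRank hF
  exact app_surjective_of_epi φ (coh_of_isVectorBundle FE.isFiniteLocallyFree.isVectorBundle).loc
    (coh_of_isVectorBundle FF.isFiniteLocallyFree.isVectorBundle).loc hV

end Literature.AlgebraicGeometry.Modules

end
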